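import Summits.CriticalPhenomena.PercolationContinuityZ3.Theses.PercAnnulusCrossing
import Summits.CriticalPhenomena.PercolationContinuityZ3.Theorems.PercTorusSliceFillingSliceFillingTransportChart
import Summits.CriticalPhenomena.PercolationContinuityZ3.Theorems.PercTorusSliceFillingTorusNonProliferationBKEventual
import Literature.Barriers.CriticalPhenomena.TimarCriticalNonunimodular
import Summits.CriticalPhenomena.PercolationContinuityZ3.Theorems.PercNonProliferationSubpolynomialBlockingUniquenessCrossRoute
import HarnessLib

/-!
# The torus no-slice-filling bound implies the critical cube-blocking seed
# (route `PercTorusSliceFilling`, crux stmt-CriticalPhenomena-5415; hardness certificate for the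
# BK stub `stub_noSliceFillingPos`)

Support file (`--supports stmt-CriticalPhenomena-5415`) written by the line lead (c3) of the crux
`TorusNonProliferation`. The BK branch of line `birth` reduces the crux to
`stub_noSliceFillingPos`: `liminf_n P_{T_n,p_c}(no open cluster of T_n is slice-filling) > 0`.
This file places that stub INSIDE the hierarchy of route `PercAnnulusCrossing`:

  `CritAnnulusNonCrossing (stmt-0846) ⟹ stub_noSliceFillingPos ⟹ CubeBlockingSeed (stmt-1141)`

(the first arrow is `noSliceFilling_eventually_pos_of_critAnnulusNonCrossing` of the companion
file `PercTorusSliceFillingTorusNonProliferationAnnulus.lean`; the second arrow is proved here, in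
the asymptotic form of the hypothesis). Hence the stub is at least as hard as the cube seed
r4 of `PercAnnulusCrossing` (the `d = 3` hyperscaling postulate of Borgs–Chayes–Kesten–Spencer,
false for `d > 6`), which certifies that it is crux-sized and not a bookkeeping step.

* `CubeSeed.exists_level_of_walk` — discrete intermediate values: a walk whose steps raise the
  first coordinate by at most one visits every level between its endpoints.
* `CubeSeed.sf_of_cubeCrossing` — POINTWISE: wrap the cube `Q_n = [0,n]³ ⊂ ℤ³` once around the
  torus `T_{n+1}` by `proj` (injective on `Q_n`; `ℤ³`-edges of the cube go to torus edges, the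
  torus only ADDS the wrap-around edges); an open bottom-to-top crossing of the cube using cube
  edges becomes an open torus path visiting all `n + 1` slices, i.e. a slice-filling cluster.
* `CubeSeed.real_cubeCrossing_le` — for every `p` and every `n`,
  `P_{ℤ³,p}([0,n]³ crossed from {x₀=0} to {x₀=n} inside the cube) ≤ P_{T_{n+1},p}(some cluster is sf)`
  (laws: `bondPercolation_map_comap` on both sides and `bondPercolation_map_inter_edgeSet` to forget
  the wrap-around edges, whose states the crossing event does not read).
* `cubeBlockingSeed_of_noSliceFilling_eventually_pos` — the implication, small cubes being
  blocked with positive probability by finite energy (the landed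
  `SubpolynomialBlocking.UniquenessCrossRoute.cubeSeal_real_pos`, `0 < p_c(ℤ³) < 1`).

Pure proof file: no definitions; every statement over existing declarations.
-/

noncomputable section

namespace Summit.CriticalPhenomena.PercolationContinuityZ3.Theorems

open MeasureTheory ProbabilityTheory
open Literature.Probability.Percolation Literature.Probability.LatticeModels
open Summit.CriticalPhenomena.PercolationContinuityZ3.Theses
open scoped Classical

namespace CubeSeed

open SliceFillingTransportProof

/-- The corner vector `(n, n, n)` in coordinates. -/
theorem vec3_apply (n : ℤ) (i : Fin 3) : (![n, n, n] : Site 3) i = n := by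
  fin_cases i <;> rfl

/-- Coordinates of a point of the cube `Q_n = [0, n]³` lie in `[0, n]`. -/
theorem coord_mem_of_mem_cube {n : ℕ} {a : Site 3}
    (ha : a ∈ (Finset.Icc (0 : Site 3) ![(n : ℤ), n, n] : Set (Site 3))) (i : Fin 3) :
    0 ≤ a i ∧ a i ≤ n := by
  rw [Finset.mem_coe, Finset.mem_Icc] at ha
  have h1 := ha.1 i
  have h2 := ha.2 i
  rw [vec3_apply] at h2
  exact ⟨h1, h2⟩

/-- **The cube wraps once around the torus injectively**: `proj : Q_n → T_{n+1}` is injective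
(coordinates differ by at most `n < n + 1`). [folklore] -/
theorem proj_injective_cube (n : ℕ) :
    Function.Injective (fun a : (Finset.Icc (0 : Site 3) ![(n : ℤ), n, n] : Set (Site 3)) =>
      Torus.proj (n + 1) (a : Site 3)) := by
  intro a b h
  apply Subtype.ext
  funext i
  have hi : ((a : Site 3) i : ZMod (n + 1)) = ((b : Site 3) i : ZMod (n + 1)) := by
    have := congr_fun h i
    simpa only [Torus.proj_apply] using this
  have hab : (((a : Site 3) i - (b : Site 3) i : ℤ) : ZMod (n + 1)) = 0 := by
    rw [Int.cast_sub, hi, sub_self]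
  have habs : |(a : Site 3) i - (b : Site 3) i| < (n + 1 : ℕ) := by
    have h1 := coord_mem_of_mem_cube a.2 i
    have h2 := coord_mem_of_mem_cube b.2 i
    rw [abs_lt]; push_cast; constructor <;> linarith
  have := int_eq_zero_of_cast_zmod_eq_zero habs hab
  linarith

/-- **Cube edges are torus edges**: the cube graph (pull-back of `ℤ³` to `Q_n`) is a subgraph of
the pull-back of the torus `T_{n+1}` along `proj` (the torus only adds the wrap-around edges).
[folklore] -/
theorem comap_cube_le (n : ℕ) :
    (zdGraph 3).comap (Subtype.val : (Finset.Icc (0 : Site 3) ![(n : ℤ), n, n] : Set (Site 3)) → Site 3) ≤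
      (torusGraph 3 (n + 1)).comap
        (fun a : (Finset.Icc (0 : Site 3) ![(n : ℤ), n, n] : Set (Site 3)) =>
          Torus.proj (n + 1) (a : Site 3)) := by
  intro a b hab
  rw [SimpleGraph.comap_adj] at hab ⊢
  have hne : Torus.proj (n + 1) (a : Site 3) ≠ Torus.proj (n + 1) (b : Site 3) := fun h =>
    hab.ne (congrArg Subtype.val (proj_injective_cube n h))
  rw [torusGraph_adj_iff]
  refine ⟨hne, ?_⟩
  rw [zdGraph_adj_iff] at hab
  obtain ⟨i, h | h⟩ := hab
  · left
    exact ⟨i, by rw [h, proj_add_site3, proj_single]⟩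
  · right
    exact ⟨i, by rw [h, proj_add_site3, proj_single]⟩

/-- **Discrete intermediate values.** In a graph on the cube whose steps raise the first
coordinate by at most one, a walk from `u` to `v` visits every level `t` with
`u₀ ≤ t ≤ v₀`. [folklore] -/
theorem exists_level_of_walk {n : ℕ}
    {Γ : SimpleGraph (Finset.Icc (0 : Site 3) ![(n : ℤ), n, n] : Set (Site 3))}
    (hΓ : ∀ u v, Γ.Adj u v → (v : Site 3) 0 ≤ (u : Site 3) 0 + 1) :
    ∀ {u v : (Finset.Icc (0 : Site 3) ![(n : ℤ), n, n] : Set (Site 3))} (w : Γ.Walk u v) (t : ℤ),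
      (u : Site 3) 0 ≤ t → t ≤ (v : Site 3) 0 → ∃ c ∈ w.support, (c : Site 3) 0 = t
  | u, _, SimpleGraph.Walk.nil, t, h1, h2 => ⟨u, by simp, le_antisymm h1 h2⟩
  | u, v, SimpleGraph.Walk.cons (v := u') hadj w', t, h1, h2 => by
    by_cases ht : (u : Site 3) 0 = t
    · exact ⟨u, by simp, ht⟩
    · have hu' : (u' : Site 3) 0 ≤ t := by
        have := hΓ u u' hadj
        omega
      obtain ⟨c, hc, hct⟩ := exists_level_of_walk hΓ w' t hu' h2
      exact ⟨c, by simp [hc], hct⟩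

/-- **Pointwise: a cube crossing wrapped around `T_{n+1}` is a slice-filling cluster.** Let
`η'` be the torus configuration pulled back to the cube along `proj` and restricted to the cube
edges. If `η'` joins a vertex of the face `{x₀ = 0}` to a vertex of the face `{x₀ = n}`, then the
torus cluster of the image of the starting vertex meets every slice `{y₀ = t}`, `t ∈ ZMod (n+1)`.
[folklore] -/
theorem sf_of_cubeCrossing (n : ℕ) (ω : BondConfig (TorusSite 3 (n + 1)))
    {a b : (Finset.Icc (0 : Site 3) ![(n : ℤ), n, n] : Set (Site 3))}
    (ha : (a : Site 3) 0 = 0) (hb : (b : Site 3) 0 = n)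
    (hr : (openGraph (restrictConfig
        (fun a : (Finset.Icc (0 : Site 3) ![(n : ℤ), n, n] : Set (Site 3)) =>
          Torus.proj (n + 1) (a : Site 3)) ω ∩
        ((zdGraph 3).comap (Subtype.val :
          (Finset.Icc (0 : Site 3) ![(n : ℤ), n, n] : Set (Site 3)) → Site 3)).edgeSet)).Reachable a b) :
    ∃ x : TorusSite 3 (n + 1), ∃ i : Fin 3, ∀ t : ZMod (n + 1),
      ∃ y ∈ openCluster ω x, y i = t := by
  haveI : NeZero (n + 1) := ⟨by omega⟩
  -- steps of the open cube graph are cube edges, hence raise the first coordinate by at most one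
  have hstep : ∀ u v : (Finset.Icc (0 : Site 3) ![(n : ℤ), n, n] : Set (Site 3)),
      (openGraph (restrictConfig
        (fun a : (Finset.Icc (0 : Site 3) ![(n : ℤ), n, n] : Set (Site 3)) =>
          Torus.proj (n + 1) (a : Site 3)) ω ∩
        ((zdGraph 3).comap (Subtype.val :
          (Finset.Icc (0 : Site 3) ![(n : ℤ), n, n] : Set (Site 3)) → Site 3)).edgeSet)).Adj u v →
        (v : Site 3) 0 ≤ (u : Site 3) 0 + 1 := by
    intro u v huv
    rw [openGraph_adj] at huv
    have hH' : ((zdGraph 3).comap (Subtype.val :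
        (Finset.Icc (0 : Site 3) ![(n : ℤ), n, n] : Set (Site 3)) → Site 3)).Adj u v := by
      have := huv.1.2
      rwa [SimpleGraph.mem_edgeSet] at this
    rw [SimpleGraph.comap_adj, zdGraph_adj_iff] at hH'
    obtain ⟨i, h | h⟩ := hH'
    · rw [h, Pi.add_apply]
      rcases eq_or_ne (0 : Fin 3) i with rfl | h0
      · simp
      · simp [Pi.single_eq_of_ne h0]
    · have : (u : Site 3) 0 = (v : Site 3) 0 + (Pi.single i (1 : ℤ) : Site 3) 0 := by
        rw [h, Pi.add_apply]
      rcases eq_or_ne (0 : Fin 3) i with rfl | h0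
      · simp at this; omega
      · simp [Pi.single_eq_of_ne h0] at this; omega
  obtain ⟨w⟩ := hr
  refine ⟨Torus.proj (n + 1) (a : Site 3), 0, fun t => ?_⟩
  -- the level `t.val ∈ [0, n]` is visited by the walk
  have htv : (t.val : ℤ) ≤ n := by
    have := ZMod.val_lt t
    omega
  obtain ⟨c, hc, hct⟩ := exists_level_of_walk hstep w (t.val : ℤ) (by rw [ha]; positivity)
    (by rw [hb]; exact htv)
  refine ⟨Torus.proj (n + 1) (c : Site 3), ?_, ?_⟩
  · -- `proj c` lies in the torus cluster of `proj a`
    have hreach := (w.takeUntil c hc).reachable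
    have hmono : openGraph (restrictConfig
        (fun a : (Finset.Icc (0 : Site 3) ![(n : ℤ), n, n] : Set (Site 3)) =>
          Torus.proj (n + 1) (a : Site 3)) ω ∩
        ((zdGraph 3).comap (Subtype.val :
          (Finset.Icc (0 : Site 3) ![(n : ℤ), n, n] : Set (Site 3)) → Site 3)).edgeSet) ≤
        openGraph (restrictConfig
          (fun a : (Finset.Icc (0 : Site 3) ![(n : ℤ), n, n] : Set (Site 3)) =>
            Torus.proj (n + 1) (a : Site 3)) ω) :=
      openGraph_mono Set.inter_subset_left
    exact reachable_map_of_restrictConfig (proj_injective_cube n) ω (hreach.mono hmono)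
  · show Torus.proj (n + 1) (c : Site 3) 0 = t
    rw [Torus.proj_apply, hct, Int.cast_natCast, ZMod.natCast_zmod_val]

/-- **Law: the cube crossing of `ℤ³` is at most as likely as a slice-filling cluster of
`T_{n+1}`** (every `p`, every `n`): the cube crossing event reads only the cube edges, whose joint
law is Bernoulli(`p`) both under `P_{ℤ³,p}` (`bondPercolation_map_comap` along the inclusion) and
under `P_{T_{n+1},p}` pulled back along `proj` and stripped of the wrap-around edges
(`bondPercolation_map_comap`, `bondPercolation_map_inter_edgeSet`); pointwise
`sf_of_cubeCrossing`. [folklore] -/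
theorem real_cubeCrossing_le (p : unitInterval) (n : ℕ) :
    (bondPercolation (zdGraph 3) p).real {ω | ∃ x ∈ Finset.Icc (0 : Site 3) ![(n : ℤ), n, n],
        ∃ y ∈ Finset.Icc (0 : Site 3) ![(n : ℤ), n, n], x 0 = 0 ∧ y 0 = n ∧
          ω ∈ openConnIn ↑(Finset.Icc (0 : Site 3) ![(n : ℤ), n, n]) x y} ≤
      (bondPercolation (torusGraph 3 (n + 1)) p).real {ω | ∃ x : TorusSite 3 (n + 1),
        ∃ i : Fin 3, ∀ t : ZMod (n + 1), ∃ y ∈ openCluster ω x, y i = t} := by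
  set Q := (Finset.Icc (0 : Site 3) ![(n : ℤ), n, n] : Set (Site 3)) with hQ
  set f : Q → TorusSite 3 (n + 1) := fun a => Torus.proj (n + 1) (a : Site 3) with hf
  set H := (zdGraph 3).comap (Subtype.val : Q → Site 3) with hH
  set G' := (torusGraph 3 (n + 1)).comap f with hG'
  have hHG' : H ≤ G' := comap_cube_le n
  have hfinj : Function.Injective f := proj_injective_cube n
  -- the local crossing event on configurations of the cube
  set A : Set (BondConfig Q) := {η | ∃ a b : Q, (a : Site 3) 0 = 0 ∧ (b : Site 3) 0 = n ∧
      (openGraph η).Reachable a b} with hA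
  -- `ℤ³` side: the crossing event is the pull-back of `A` along the restriction to the cube
  have hZ : {ω : BondConfig (Site 3) | ∃ x ∈ Finset.Icc (0 : Site 3) ![(n : ℤ), n, n],
        ∃ y ∈ Finset.Icc (0 : Site 3) ![(n : ℤ), n, n], x 0 = 0 ∧ y 0 = n ∧
          ω ∈ openConnIn ↑(Finset.Icc (0 : Site 3) ![(n : ℤ), n, n]) x y} ⊆
      restrictConfig (Subtype.val : Q → Site 3) ⁻¹' A := by
    rintro ω ⟨x, hx, y, hy, hx0, hy0, hxQ, hyQ, hr⟩
    refine ⟨⟨x, hxQ⟩, ⟨y, hyQ⟩, hx0, hy0, ?_⟩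
    rw [induce_openGraph_eq] at hr
    exact hr
  -- torus side: pointwise, `A` after forgetting the wrap-around edges forces a sf cluster
  have hT : (fun η : BondConfig Q => η ∩ H.edgeSet) ∘ restrictConfig f ⁻¹' A ⊆
      {ω : BondConfig (TorusSite 3 (n + 1)) | ∃ x : TorusSite 3 (n + 1),
        ∃ i : Fin 3, ∀ t : ZMod (n + 1), ∃ y ∈ openCluster ω x, y i = t} := by
    rintro ω ⟨a, b, ha, hb, hr⟩
    exact sf_of_cubeCrossing n ω ha hb hr
  -- the laws
  have hmeasI : Measurable (fun η : BondConfig Q => η ∩ H.edgeSet) := measurable_of_finite _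
  have hlawZ : (bondPercolation (zdGraph 3) p).map (restrictConfig (Subtype.val : Q → Site 3)) =
      bondPercolation H p := bondPercolation_map_comap _ Subtype.val_injective p
  have hlawT : ((bondPercolation (torusGraph 3 (n + 1)) p).map (restrictConfig f)).map
      (fun η : BondConfig Q => η ∩ H.edgeSet) = bondPercolation H p := by
    rw [bondPercolation_map_comap _ hfinj p]
    exact Literature.Barriers.CriticalPhenomena.bondPercolation_map_inter_edgeSet hHG' p
  calc (bondPercolation (zdGraph 3) p).real {ω | ∃ x ∈ Finset.Icc (0 : Site 3) ![(n : ℤ), n, n],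
          ∃ y ∈ Finset.Icc (0 : Site 3) ![(n : ℤ), n, n], x 0 = 0 ∧ y 0 = n ∧
            ω ∈ openConnIn ↑(Finset.Icc (0 : Site 3) ![(n : ℤ), n, n]) x y}
      ≤ (bondPercolation (zdGraph 3) p).real (restrictConfig (Subtype.val : Q → Site 3) ⁻¹' A) :=
        measureReal_mono hZ
    _ = (bondPercolation H p).real A := by
        rw [← hlawZ, map_measureReal_apply (measurable_restrictConfig _) MeasurableSet.of_discrete]
    _ = (bondPercolation (torusGraph 3 (n + 1)) p).real
          ((fun η : BondConfig Q => η ∩ H.edgeSet) ∘ restrictConfig f ⁻¹' A) := by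
        rw [← hlawT, Measure.map_map hmeasI (measurable_restrictConfig _),
          map_measureReal_apply (hmeasI.comp (measurable_restrictConfig _))
            MeasurableSet.of_discrete]
    _ ≤ _ := measureReal_mono hT

end CubeSeed

open CubeSeed

/-- **The torus no-slice-filling bound implies the cube-blocking seed.** If the critical
3-torus has no slice-filling cluster with probability bounded away from zero eventually in `n`
(`∃ c > 0, ∃ N, ∀ n ≥ N, P_{T_n,p_c}(∀ x, C(x) not sf) ≥ c` — the BK stub of line `birth` in its
asymptotic form; NOT proved, open in `d = 3`), then `CubeBlockingSeed` (item
stmt-CriticalPhenomena-1141 of route `PercAnnulusCrossing`): the critical cube `[0,n]³` fails to be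
crossed face to face with probability bounded away from zero, uniformly in `n ≥ 1`. For
`n + 1 ≥ N` this is `real_cubeCrossing_le` (`P(cube crossed) ≤ P_{T_{n+1}}(∃ sf) ≤ 1 - c`);
the finitely many smaller cubes are blocked with positive probability (finite energy, the landed
`SubpolynomialBlocking.UniquenessCrossRoute.cubeSeal_real_pos`).
[folklore] -/
theorem cubeBlockingSeed_of_noSliceFilling_eventually_pos : (∃ c : ℝ, 0 < c ∧ ∃ N : ℕ, ∀ n : ℕ, N ≤ n → c ≤ (Literature.Probability.Percolation.bondPercolation (Literature.Probability.LatticeModels.torusGraph 3 n) (Literature.Probability.Percolation.criticalProbI 3)).real {ω | ∀ x : Literature.Probability.LatticeModels.TorusSite 3 n, ¬ ∃ i : Fin 3, ∀ t : ZMod n, ∃ y ∈ Literature.Probability.Percolation.openCluster ω x, y i = t}) → Summit.CriticalPhenomena.PercolationContinuityZ3.Theses.PercAnnulusCrossing.CubeBlockingSeed := by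
  rintro ⟨c, hc, N, hN⟩
  unfold PercAnnulusCrossing.CubeBlockingSeed
  -- `g n = P_{p_c}(cube Q_n blocked)`
  set g : ℕ → ℝ := fun n => (bondPercolation (zdGraph 3) (criticalProbI 3)).real
    {ω | ¬ ∃ x ∈ Finset.Icc (0 : Site 3) ![(n : ℤ), n, n],
      ∃ y ∈ Finset.Icc (0 : Site 3) ![(n : ℤ), n, n], x 0 = 0 ∧ y 0 = n ∧
        ω ∈ openConnIn ↑(Finset.Icc (0 : Site 3) ![(n : ℤ), n, n]) x y} with hg
  -- large cubes: wrap around the torus `T_{n+1}`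
  have hlarge : ∀ n : ℕ, N ≤ n + 1 → c ≤ g n := by
    intro n hnN
    haveI : NeZero (n + 1) := ⟨by omega⟩
    set μT := bondPercolation (torusGraph 3 (n + 1)) (criticalProbI 3) with hμT
    set E : Set (BondConfig (TorusSite 3 (n + 1))) := {ω | ∃ x : TorusSite 3 (n + 1),
        ∃ i : Fin 3, ∀ t : ZMod (n + 1), ∃ y ∈ openCluster ω x, y i = t} with hE
    set Cz : Set (BondConfig (Site 3)) := {ω | ∃ x ∈ Finset.Icc (0 : Site 3) ![(n : ℤ), n, n],
        ∃ y ∈ Finset.Icc (0 : Site 3) ![(n : ℤ), n, n], x 0 = 0 ∧ y 0 = n ∧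
          ω ∈ openConnIn ↑(Finset.Icc (0 : Site 3) ![(n : ℤ), n, n]) x y} with hCz
    have h1 : (bondPercolation (zdGraph 3) (criticalProbI 3)).real Cz ≤ μT.real E :=
      real_cubeCrossing_le (criticalProbI 3) n
    have h2 : μT.real E + μT.real Eᶜ = 1 :=
      probReal_add_probReal_compl (Set.toFinite _).measurableSet
    have h3 : c ≤ μT.real Eᶜ := by
      have hset : Eᶜ = {ω : BondConfig (TorusSite 3 (n + 1)) | ∀ x : TorusSite 3 (n + 1),
          ¬ ∃ i : Fin 3, ∀ t : ZMod (n + 1), ∃ y ∈ openCluster ω x, y i = t} := by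
        ext ω
        simp only [hE, Set.mem_compl_iff, Set.mem_setOf_eq, not_exists]
      rw [hset]
      exact hN (n + 1) hnN
    have h4 : 1 ≤ (bondPercolation (zdGraph 3) (criticalProbI 3)).real Cz +
        (bondPercolation (zdGraph 3) (criticalProbI 3)).real Czᶜ := by
      calc (1 : ℝ) = (bondPercolation (zdGraph 3) (criticalProbI 3)).real Set.univ :=
            probReal_univ.symm
        _ = (bondPercolation (zdGraph 3) (criticalProbI 3)).real (Cz ∪ Czᶜ) := by
            rw [Set.union_compl_self]
        _ ≤ _ := measureReal_union_le _ _
    have h5 : g n = (bondPercolation (zdGraph 3) (criticalProbI 3)).real Czᶜ := rfl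
    rw [h5]
    linarith
  -- all cubes: positive minimum over the finitely many small ones
  set c₀ : ℕ → ℝ := fun n => if 1 ≤ n then min c (g n) else c with hc₀
  have hc₀pos : ∀ n, 0 < c₀ n := by
    intro n
    simp only [hc₀]
    split_ifs with h1
    · exact lt_min hc (SubpolynomialBlocking.UniquenessCrossRoute.cubeSeal_real_pos n h1)
    · exact hc
  set T : Finset ℕ := Finset.range (N + 3) with hT
  have hTne : T.Nonempty := ⟨0, Finset.mem_range.2 (by omega)⟩
  set c' : ℝ := T.inf' hTne c₀ with hc'
  have hc'pos : 0 < c' := (Finset.lt_inf'_iff hTne).2 fun n _ => hc₀pos n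
  have hc'le : ∀ n ∈ T, c' ≤ c₀ n := fun n hn => Finset.inf'_le c₀ hn
  refine ⟨c', hc'pos, fun n hn => ?_⟩
  show c' ≤ g n
  by_cases hsmall : n ∈ T
  · calc c' ≤ c₀ n := hc'le n hsmall
      _ = min c (g n) := by simp only [hc₀, if_pos hn]
      _ ≤ g n := min_le_right _ _
  · have hnT : N + 3 ≤ n := by
      rw [hT, Finset.mem_range] at hsmall
      omega
    calc c' ≤ c₀ 1 := hc'le 1 (Finset.mem_range.2 (by omega))
      _ = min c (g 1) := by simp only [hc₀, if_pos le_rfl]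
      _ ≤ c := min_le_left _ _
      _ ≤ g n := hlarge n (by omega)

end Summit.CriticalPhenomena.PercolationContinuityZ3.Theorems

end
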